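import Summits.Ventures.PercRepro.RankLevelSetCountBounds

/-!
# PercRepro — the `j`-subsets MEETING a set `S` (p8 g12, S3): `#{B ⊆ E : |B| = j, B ∩ S ≠ ∅} + C(|E| − |S|, j) ≤ C(|E|, j)`

The counting half of THE CONFINEMENT LEMMA's corollaries (RankLevelSetConfinement.lean): at `(22, 7)`, two distinct
triangles `C₁ ≠ C₂` force every independent coindependent `6`-set to meet `S = C₁ ∪ C₂`, so those sets number at most
`C(29, 6) − C(29 − |S|, 6) ≤ C(29, 6) − C(23, 6)` (`proofs/P8-G12-LEVER22.md` §2). On night-1's `ncard_subsets_ncard_eq`.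
Axioms: standard.
-/

namespace PercRepro

open Finset Set

variable {α : Type*}

/-- The `j`-subsets of a finset `E` contained in `E ∖ S` number `C(|E| − |S|, j)` (`S ⊆ E`). -/
theorem ncard_subsets_diff_ncard_eq (E : Finset α) (S : Set α) (hS : S ⊆ (E : Set α)) (j : ℕ) :
    {B : Set α | B ⊆ ((E : Set α) \ S) ∧ B.ncard = j}.ncard = (E.card - S.ncard).choose j := by
  classical
  have hcoe : (((E.filter (fun x => x ∉ S)) : Finset α) : Set α) = (E : Set α) \ S := by
    ext x
    simp only [Finset.coe_filter, Set.mem_setOf_eq, Set.mem_sdiff, Finset.mem_coe]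
  have hcard : (E.filter (fun x => x ∉ S)).card = E.card - S.ncard := by
    have h1 := Finset.card_filter_add_card_filter_not (s := E) (fun x => x ∈ S)
    have h2 : (E.filter (fun x => x ∈ S)).card = S.ncard := by
      have hset : (((E.filter (fun x => x ∈ S)) : Finset α) : Set α) = S := by
        ext x
        simp only [Finset.coe_filter, Set.mem_setOf_eq]
        exact ⟨fun h => h.2, fun hx => ⟨hS hx, hx⟩⟩
      rw [← Set.ncard_coe_finset, hset]
    omega
  rw [← hcoe, ncard_subsets_ncard_eq, hcard]

/-- **The subsets meeting `S`**: the `j`-subsets of `E` that meet `S` and the `j`-subsets of `E ∖ S` together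
number at most `C(|E|, j)` — so the former number at most `C(|E|, j) − C(|E| − |S|, j)`. -/
theorem ncard_subsets_meeting_add_choose_le (E : Finset α) (S : Set α) (hS : S ⊆ (E : Set α)) (j : ℕ) :
    {B : Set α | B ⊆ (E : Set α) ∧ B.ncard = j ∧ (B ∩ S).Nonempty}.ncard
      + (E.card - S.ncard).choose j ≤ E.card.choose j := by
  classical
  have hdisj : Disjoint {B : Set α | B ⊆ (E : Set α) ∧ B.ncard = j ∧ (B ∩ S).Nonempty}
      {B : Set α | B ⊆ ((E : Set α) \ S) ∧ B.ncard = j} := by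
    rw [Set.disjoint_left]
    rintro B ⟨_, _, ⟨x, hxB, hxS⟩⟩ ⟨hB, _⟩
    exact (hB hxB).2 hxS
  have hsub : {B : Set α | B ⊆ (E : Set α) ∧ B.ncard = j ∧ (B ∩ S).Nonempty} ∪
      {B : Set α | B ⊆ ((E : Set α) \ S) ∧ B.ncard = j} ⊆
        {X : Set α | X ⊆ (E : Set α) ∧ X.ncard = j} := by
    rintro B (⟨h1, h2, _⟩ | ⟨h1, h2⟩)
    · exact ⟨h1, h2⟩
    · exact ⟨h1.trans Set.sdiff_subset, h2⟩
  have hfin : {X : Set α | X ⊆ (E : Set α) ∧ X.ncard = j}.Finite :=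
    E.finite_toSet.finite_subsets.subset (fun X hX => hX.1)
  have hfin1 : {B : Set α | B ⊆ (E : Set α) ∧ B.ncard = j ∧ (B ∩ S).Nonempty}.Finite :=
    hfin.subset (Set.subset_union_left.trans hsub)
  have hfin2 : {B : Set α | B ⊆ ((E : Set α) \ S) ∧ B.ncard = j}.Finite :=
    hfin.subset (Set.subset_union_right.trans hsub)
  rw [← ncard_subsets_diff_ncard_eq E S hS j, ← Set.ncard_union_eq hdisj hfin1 hfin2,
    ← ncard_subsets_ncard_eq E j]
  exact Set.ncard_le_ncard hsub hfin

/-- The same with a cap `|S| ≤ s₀` on the met set (at `(22, 7)`: `S = C₁ ∪ C₂`, `s₀ = 6`):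
`#{B ⊆ E : |B| = j, B ∩ S ≠ ∅} + C(|E| − s₀, j) ≤ C(|E|, j)`. -/
theorem ncard_subsets_meeting_add_choose_le_of_ncard_le (E : Finset α) (S : Set α)
    (hS : S ⊆ (E : Set α)) (j s₀ : ℕ) (hs : S.ncard ≤ s₀) :
    {B : Set α | B ⊆ (E : Set α) ∧ B.ncard = j ∧ (B ∩ S).Nonempty}.ncard
      + (E.card - s₀).choose j ≤ E.card.choose j := by
  have h1 : (E.card - s₀).choose j ≤ (E.card - S.ncard).choose j :=
    Nat.choose_le_choose j (Nat.sub_le_sub_left hs E.card)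
  have h2 := ncard_subsets_meeting_add_choose_le E S hS j
  omega

end PercRepro
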